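import Mathlib
import Summits.Ventures.HodgeRepro.Tier4.Common.AdelicDefs
import Summits.Ventures.HodgeRepro.Tier4.Line1.PlaneDefs
import Summits.Ventures.HodgeRepro.Tier4.Line1.RowBasis
import Summits.Ventures.HodgeRepro.Tier4.Line1.RationalSolutions
import Summits.Ventures.HodgeRepro.Tier4.Line1.RationalConjScalar
import Summits.Ventures.HodgeRepro.Tier4.Line1.RationalConjSystem

/-!
# Tier4/Line1/RationalConj — LINE L1, (iii′) `exists_rational_conj`: THE CORE OF J2.b — two rational points of one
adelic `T × T′`-orbit are conjugate by RATIONAL elements of the tori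

Blind re-derivation cell `pub-hodge-repro`, Tier 4 «prove the step» (README §9–§10), seat t4-L1-p2 (prover, gen 0),
LINE L1, assignment S12586 (plan-1 g1; statement byte-identical to Skeleton v0.17–v0.19, v0.19 L588–L590).
THE PROOF (plan-1 g1's (C) with the two remarks of S12596), row convention: for `t ∈ T(𝔸)`, `t′ ∈ T′(𝔸)` with
`t⁻¹ γ t′ = γ₀`: (1)–(2) `t` acts on the rational row line `W₀ = {v P₀}` as an `E′_𝔸`-scalar `x + yΩ` of norm
`x² + d y² = 1` (`RationalConjScalar`, unitarity on a rational `w` with `β(w, w) ≠ 0` by definiteness); (3) `S = x − yΩ`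
is a central unitary in both tori and `(δ, δ′) = (S t, S t′)` satisfies `δ⁻¹ γ δ′ = γ₀` and `P₀ δ = P₀`
(`RationalConjSystem`); (4) the RATIONAL linear system «`X ∈ A_T`, `X′ ∈ A_{T′}`, `X Γ₀ = Γ X′`, `P₀ X = P₀`»
(`Γ, Γ₀` the rational matrices of `γ, γ₀`) has `(δ, δ′)` as its UNIQUE adelic solution (`sys_unique`, from
`IsLinRegular`); (5) a rational linear system with a unique adelic solution has a RATIONAL one
(`RationalSolutions.exists_rational_of_unique`: a `k`-linear left inverse of the injective rational map, extended to
`𝔸_k` on the standard bases of `M₄ × M₄` and `Fin 8 → M₄`), so `δ, δ′` are images of rational matrices;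
(6) an element of `U(W)(𝔸_k)` with a rational matrix is a rational point (`mem_rationalPoints_of_mat`).
Mathlib only through the landed modules: no Galois cohomology, no Hasse norm theorem, no place decomposition.
`#print axioms exists_rational_conj` = [propext, Classical.choice, Quot.sound].

Nothing here says anything about the status of the Hodge conjecture for CM abelian varieties, which is NOT proved
(HC_CM is NOT proved by anyone in this repository).
-/

set_option autoImplicit false

noncomputable section

namespace Summit.Ventures.HodgeRepro.Tier4.Line1

open Matrix NumberField Summit.Ventures.HodgeRepro.Tier4.Common


/-! ### THE THEOREM (iii′): rational conjugators -/

section Main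

open Module

variable {k : Type} [Field k] [NumberField k] (W : PlaneData k)

/-- the rational matrix of a rational point -/
theorem exists_adMat_of_rationalPoint (γ : rationalPoints W) :
    ∃ g : Matrix (Fin 4) (Fin 4) k, GA.mat W (γ : GA W) = adMat k g := by
  have h : ((γ : GA W) : GL4 k) ∈ principalGL (k := k) := Subgroup.mem_subgroupOf.1 γ.2
  obtain ⟨u, hu⟩ := MonoidHom.mem_range.1 h
  refine ⟨(u : Matrix (Fin 4) (Fin 4) k), ?_⟩
  rw [GA.mat, ← hu]
  rfl

/-- the matrix of `(s * t)` with `s` of matrix `S` -/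
theorem GA.mat_mul' (s t : GA W) : GA.mat W (s * t) = GA.mat W s * GA.mat W t := rfl

/-- **(iii′), THE CORE OF J2.b: two rational points of one adelic `T × T′`-orbit are conjugate by RATIONAL
elements of the tori.**  For `t ∈ T(𝔸)`, `t′ ∈ T′(𝔸)` with `t⁻¹ γ t′ = γ₀`, the `E′_𝔸`-scalar `t₀ = x + yΩ` by
which `t` acts on the line `W₀` has norm `1` (unitarity + definiteness), `S = x − yΩ` is a central unitary in both
tori, and `(δ, δ′) = (S t, S t′)` is the UNIQUE adelic solution of the RATIONAL linear system «`X ∈ A_T`,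
`X′ ∈ A_{T′}`, `X γ₀ = γ X′`, `P₀ X = P₀`» (uniqueness by linear regularity), hence RATIONAL
(`exists_rational_of_unique`). -/
theorem exists_rational_conj (hW : IsDefinite W) (hg : IsGenuineRow W) (γ γ₀ : rationalPoints W)
    (hreg : IsLinRegular W γ₀) (h : ∃ t ∈ torusT W, ∃ t' ∈ torusT' W, t⁻¹ * γ * t' = γ₀) :
    ∃ δ ∈ torusT W, ∃ δ' ∈ torusT' W, δ ∈ rationalPoints W ∧ δ' ∈ rationalPoints W ∧ δ⁻¹ * γ * δ' = γ₀ := by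
  obtain ⟨⟨d, hΩ, hd⟩, hΩB, -, -, hPrank, -⟩ := hg
  obtain ⟨t, ht, t', ht', hγ⟩ := h
  obtain ⟨g, hg⟩ := exists_adMat_of_rationalPoint W γ
  obtain ⟨g₀, hg₀⟩ := exists_adMat_of_rationalPoint W γ₀
  -- the matrices of `t`, `t′` and their inverses
  have hTΩ : GA.mat W t * adMat k W.Ω = adMat k W.Ω * GA.mat W t :=
    ((mem_unitaryGroup W _).1 t.2).1
  have hTB : GA.mat W t * adMat k W.B * (GA.mat W t).transpose = adMat k W.B :=
    ((mem_unitaryGroup W _).1 t.2).2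
  have hTP : ∀ i, GA.mat W t * adMat k (W.P i) = adMat k (W.P i) * GA.mat W t := by
    intro i
    fin_cases i
    · exact ht.1
    · exact ht.2
  have hT'Ω : GA.mat W t' * adMat k W.Ω = adMat k W.Ω * GA.mat W t' :=
    ((mem_unitaryGroup W _).1 t'.2).1
  have hT'Q : ∀ i, GA.mat W t' * adMat k (W.Q i) = adMat k (W.Q i) * GA.mat W t' := by
    intro i
    fin_cases i
    · exact ht'.1
    · exact ht'.2
  have hti : t⁻¹ ∈ torusT W := (torusT W).inv_mem ht
  have hti' : t'⁻¹ ∈ torusT' W := (torusT' W).inv_mem ht'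
  have hTiΩ : GA.mat W t⁻¹ * adMat k W.Ω = adMat k W.Ω * GA.mat W t⁻¹ :=
    ((mem_unitaryGroup W _).1 (t⁻¹).2).1
  have hTiP : ∀ i, GA.mat W t⁻¹ * adMat k (W.P i) = adMat k (W.P i) * GA.mat W t⁻¹ := by
    intro i
    fin_cases i
    · exact hti.1
    · exact hti.2
  have hTi'Ω : GA.mat W t'⁻¹ * adMat k W.Ω = adMat k W.Ω * GA.mat W t'⁻¹ :=
    ((mem_unitaryGroup W _).1 (t'⁻¹).2).1
  have hTi'Q : ∀ i, GA.mat W t'⁻¹ * adMat k (W.Q i) = adMat k (W.Q i) * GA.mat W t'⁻¹ := by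
    intro i
    fin_cases i
    · exact hti'.1
    · exact hti'.2
  -- the conjugation identity at the matrix level: `Γ T′ = T Γ₀`
  have hγ' : (γ : GA W) * t' = t * γ₀ := by
    have := congrArg (fun z => t * z) hγ
    simpa only [mul_assoc, mul_inv_cancel_left] using this
  have hΓ : adMat k g * GA.mat W t' = GA.mat W t * adMat k g₀ := by
    rw [← hg, ← hg₀, ← GA.mat_mul', ← GA.mat_mul', hγ']
  -- the rational row vectors `w ∈ W₀`, `w₁ ∈ W₁`
  obtain ⟨v, hv⟩ := exists_vecMul_ne_zero (ne_zero_of_rank_two (hPrank 0))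
  obtain ⟨v₁, hv₁⟩ := exists_vecMul_ne_zero (ne_zero_of_rank_two (hPrank 1))
  have hw : (v ᵥ* W.P 0) ᵥ* W.P 0 = v ᵥ* W.P 0 := by rw [Matrix.vecMul_vecMul, W.P_idem 0]
  have hw₁ : (v₁ ᵥ* W.P 1) ᵥ* W.P 0 = 0 := by
    rw [Matrix.vecMul_vecMul, P1_mul_P0 W, Matrix.vecMul_zero]
  have hβ := form_self_ne_zero W hW hv
  -- the scalar action of `T` on `W₀` and its norm
  obtain ⟨x, y, hxy⟩ := exists_row_coords W hΩ hd hv hv₁ hw hw₁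
    (v := (algebraMap k (Ad k) ∘ (v ᵥ* W.P 0)) ᵥ* GA.mat W t)
    (by rw [Matrix.vecMul_vecMul, hTP 0, ← Matrix.vecMul_vecMul, vecMul_adMat_algebraMap_comp, hw])
  have hn := norm_eq_one_of_unitary W hΩ hΩB hβ hTB hxy
  -- the central unitary `S = x·1 − y·Ω`
  set S : M4 k := x • (1 : M4 k) - y • adMat k W.Ω with hS
  set Sinv : M4 k := x • (1 : M4 k) + y • adMat k W.Ω with hSinv
  have hΩΩ := adMat_Omega_mul_self W hΩ
  have hSS : S * Sinv = 1 := by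
    rw [hS, hSinv]
    simp only [Matrix.sub_mul, Matrix.mul_add, Matrix.smul_mul, Matrix.mul_smul, Matrix.one_mul,
      Matrix.mul_one, hΩΩ]
    trans (x * x + algebraMap k (Ad k) d * (y * y)) • (1 : M4 k)
    · module
    · rw [hn, one_smul]
  have hSS' : Sinv * S = 1 := by
    rw [hS, hSinv]
    simp only [Matrix.add_mul, Matrix.mul_sub, Matrix.smul_mul, Matrix.mul_smul, Matrix.one_mul,
      Matrix.mul_one, hΩΩ]
    trans (x * x + algebraMap k (Ad k) d * (y * y)) • (1 : M4 k)
    · module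
    · rw [hn, one_smul]
  have hScomm : ∀ M : M4 k, M * adMat k W.Ω = adMat k W.Ω * M → M * S = S * M := by
    intro M hM
    have := scalar_comm W hM x (-y)
    simpa [hS, sub_eq_add_neg, neg_smul] using this
  have hSΩ : S * adMat k W.Ω = adMat k W.Ω * S := (hScomm _ rfl).symm
  have hSB : S * adMat k W.B * S.transpose = adMat k W.B := scalar_mul_B_mul_transpose W hΩ hΩB hn
  let Sgl : GL4 k := ⟨S, Sinv, hSS, hSS'⟩
  have hSmem : Sgl ∈ unitaryGroup W := ⟨hSΩ, hSB⟩
  let s : GA W := ⟨Sgl, hSmem⟩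
  have hs_mat : GA.mat W s = S := rfl
  have hs_central : ∀ g : GA W, g * s = s * g := by
    intro g
    apply Subtype.ext
    apply Units.ext
    change GA.mat W g * S = S * GA.mat W g
    exact hScomm _ ((mem_unitaryGroup W _).1 g.2).1
  have hsT : s ∈ torusT W := by
    refine ⟨?_, ?_⟩
    · change S * adMat k (W.P 0) = adMat k (W.P 0) * S
      exact (hScomm _ (by rw [← adMat_mul, ← adMat_mul, W.P_comm 0])).symm
    · change S * adMat k (W.P 1) = adMat k (W.P 1) * S
      exact (hScomm _ (by rw [← adMat_mul, ← adMat_mul, W.P_comm 1])).symm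
  have hsT' : s ∈ torusT' W := by
    refine ⟨?_, ?_⟩
    · change S * adMat k (W.Q 0) = adMat k (W.Q 0) * S
      exact (hScomm _ (by rw [← adMat_mul, ← adMat_mul, W.Q_comm 0])).symm
    · change S * adMat k (W.Q 1) = adMat k (W.Q 1) * S
      exact (hScomm _ (by rw [← adMat_mul, ← adMat_mul, W.Q_comm 1])).symm
  -- RATIONALITY: `(S T, S T′)` is the unique adelic solution of a rational linear system
  have hΓΩ : adMat k g * adMat k W.Ω = adMat k W.Ω * adMat k g := by
    rw [← hg]
    exact ((mem_unitaryGroup W _).1 (γ : GA W).2).1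
  have hSΓ : S * adMat k g = adMat k g * S := (hScomm _ hΓΩ).symm
  have hrat : ∃ A A' : Matrix (Fin 4) (Fin 4) k,
      S * GA.mat W t = adMat k A ∧ S * GA.mat W t' = adMat k A' := by
    have hφinj : Function.Injective (algebraMap k (Ad k)) :=
      NumberField.AdeleRing.algebraMap_injective (𝓞 k) k
    -- the rational system and its adelic extension
    let eqk : Fin 8 → (Matrix (Fin 4) (Fin 4) k × Matrix (Fin 4) (Fin 4) k →ₗ[k] Matrix (Fin 4) (Fin 4) k) :=
      ![(LinearMap.mulRight k W.Ω - LinearMap.mulLeft k W.Ω) ∘ₗ LinearMap.fst k _ _,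
        (LinearMap.mulRight k (W.P 0) - LinearMap.mulLeft k (W.P 0)) ∘ₗ LinearMap.fst k _ _,
        (LinearMap.mulRight k (W.P 1) - LinearMap.mulLeft k (W.P 1)) ∘ₗ LinearMap.fst k _ _,
        (LinearMap.mulRight k W.Ω - LinearMap.mulLeft k W.Ω) ∘ₗ LinearMap.snd k _ _,
        (LinearMap.mulRight k (W.Q 0) - LinearMap.mulLeft k (W.Q 0)) ∘ₗ LinearMap.snd k _ _,
        (LinearMap.mulRight k (W.Q 1) - LinearMap.mulLeft k (W.Q 1)) ∘ₗ LinearMap.snd k _ _,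
        LinearMap.mulRight k g₀ ∘ₗ LinearMap.fst k _ _ - LinearMap.mulLeft k g ∘ₗ LinearMap.snd k _ _,
        LinearMap.mulLeft k (W.P 0) ∘ₗ LinearMap.fst k _ _]
    let eqR : Fin 8 → (M4 k × M4 k →ₗ[Ad k] M4 k) :=
      ![(LinearMap.mulRight (Ad k) (adMat k W.Ω) - LinearMap.mulLeft (Ad k) (adMat k W.Ω)) ∘ₗ
          LinearMap.fst (Ad k) _ _,
        (LinearMap.mulRight (Ad k) (adMat k (W.P 0)) - LinearMap.mulLeft (Ad k) (adMat k (W.P 0))) ∘ₗ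
          LinearMap.fst (Ad k) _ _,
        (LinearMap.mulRight (Ad k) (adMat k (W.P 1)) - LinearMap.mulLeft (Ad k) (adMat k (W.P 1))) ∘ₗ
          LinearMap.fst (Ad k) _ _,
        (LinearMap.mulRight (Ad k) (adMat k W.Ω) - LinearMap.mulLeft (Ad k) (adMat k W.Ω)) ∘ₗ
          LinearMap.snd (Ad k) _ _,
        (LinearMap.mulRight (Ad k) (adMat k (W.Q 0)) - LinearMap.mulLeft (Ad k) (adMat k (W.Q 0))) ∘ₗ
          LinearMap.snd (Ad k) _ _,
        (LinearMap.mulRight (Ad k) (adMat k (W.Q 1)) - LinearMap.mulLeft (Ad k) (adMat k (W.Q 1))) ∘ₗ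
          LinearMap.snd (Ad k) _ _,
        LinearMap.mulRight (Ad k) (adMat k g₀) ∘ₗ LinearMap.fst (Ad k) _ _ -
          LinearMap.mulLeft (Ad k) (adMat k g) ∘ₗ LinearMap.snd (Ad k) _ _,
        LinearMap.mulLeft (Ad k) (adMat k (W.P 0)) ∘ₗ LinearMap.fst (Ad k) _ _]
    let f : Matrix (Fin 4) (Fin 4) k × Matrix (Fin 4) (Fin 4) k →ₗ[k] (Fin 8 → Matrix (Fin 4) (Fin 4) k) :=
      LinearMap.pi eqk
    let F : M4 k × M4 k →ₗ[Ad k] (Fin 8 → M4 k) := LinearMap.pi eqR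
    -- the rational structures
    let ιV : Matrix (Fin 4) (Fin 4) k × Matrix (Fin 4) (Fin 4) k →ₗ[k] M4 k × M4 k :=
      (Algebra.linearMap k (Ad k)).mapMatrix.prodMap (Algebra.linearMap k (Ad k)).mapMatrix
    let ιW : (Fin 8 → Matrix (Fin 4) (Fin 4) k) →ₗ[k] (Fin 8 → M4 k) :=
      LinearMap.pi (fun e => (Algebra.linearMap k (Ad k)).mapMatrix ∘ₗ LinearMap.proj e)
    have hιV_apply : ∀ A A' : Matrix (Fin 4) (Fin 4) k, ιV (A, A') = (adMat k A, adMat k A') := by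
      intro A A'
      rfl
    have hιW_apply : ∀ (b : Fin 8 → Matrix (Fin 4) (Fin 4) k) (e : Fin 8), ιW b e = adMat k (b e) := by
      intro b e
      rfl
    have hstd : ∀ p : Fin 4 × Fin 4, adMat k (Matrix.stdBasis k (Fin 4) (Fin 4) p) =
        Matrix.stdBasis (Ad k) (Fin 4) (Fin 4) p := by
      rintro ⟨a, b⟩
      rw [Matrix.stdBasis_eq_single, Matrix.stdBasis_eq_single]
      unfold adMat
      rw [Matrix.map_single, map_one]
    have hadz : adMat k (0 : Matrix (Fin 4) (Fin 4) k) = 0 := Matrix.map_zero _ (map_zero _)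
    have hιV : ∀ i, ιV ((Matrix.stdBasis k (Fin 4) (Fin 4)).prod (Matrix.stdBasis k (Fin 4) (Fin 4)) i) =
        (Matrix.stdBasis (Ad k) (Fin 4) (Fin 4)).prod (Matrix.stdBasis (Ad k) (Fin 4) (Fin 4)) i := by
      rintro (p | p)
      · have e1 : (Matrix.stdBasis k (Fin 4) (Fin 4)).prod (Matrix.stdBasis k (Fin 4) (Fin 4)) (Sum.inl p) =
            (Matrix.stdBasis k (Fin 4) (Fin 4) p, 0) :=
          Prod.ext (Basis.prod_apply_inl_fst _ _ p) (Basis.prod_apply_inl_snd _ _ p)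
        have e2 : (Matrix.stdBasis (Ad k) (Fin 4) (Fin 4)).prod (Matrix.stdBasis (Ad k) (Fin 4) (Fin 4))
            (Sum.inl p) = (Matrix.stdBasis (Ad k) (Fin 4) (Fin 4) p, 0) :=
          Prod.ext (Basis.prod_apply_inl_fst _ _ p) (Basis.prod_apply_inl_snd _ _ p)
        rw [e1, e2, hιV_apply, hstd, hadz]
      · have e1 : (Matrix.stdBasis k (Fin 4) (Fin 4)).prod (Matrix.stdBasis k (Fin 4) (Fin 4)) (Sum.inr p) =
            (0, Matrix.stdBasis k (Fin 4) (Fin 4) p) :=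
          Prod.ext (Basis.prod_apply_inr_fst _ _ p) (Basis.prod_apply_inr_snd _ _ p)
        have e2 : (Matrix.stdBasis (Ad k) (Fin 4) (Fin 4)).prod (Matrix.stdBasis (Ad k) (Fin 4) (Fin 4))
            (Sum.inr p) = (0, Matrix.stdBasis (Ad k) (Fin 4) (Fin 4) p) :=
          Prod.ext (Basis.prod_apply_inr_fst _ _ p) (Basis.prod_apply_inr_snd _ _ p)
        rw [e1, e2, hιV_apply, hstd, hadz]
    have hιW : ∀ j, ιW (Pi.basis (fun _ : Fin 8 => Matrix.stdBasis k (Fin 4) (Fin 4)) j) =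
        Pi.basis (fun _ : Fin 8 => Matrix.stdBasis (Ad k) (Fin 4) (Fin 4)) j := by
      rintro ⟨e, p⟩
      rw [Pi.basis_apply, Pi.basis_apply]
      funext e'
      rw [hιW_apply]
      by_cases he : e' = e
      · subst he
        simp only [Pi.single_eq_same, hstd]
      · simp only [Pi.single_eq_of_ne he, hadz]
    have hιVinj : Function.Injective ιV := by
      rintro ⟨A, A'⟩ ⟨B, B'⟩ hAB
      rw [hιV_apply, hιV_apply, Prod.mk.injEq] at hAB
      exact Prod.ext (Matrix.map_injective hφinj hAB.1) (Matrix.map_injective hφinj hAB.2)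
    -- the adelic system extends the rational one
    have hcompat : ∀ v, F (ιV v) = ιW (f v) := by
      rintro ⟨A, A'⟩
      rw [hιV_apply]
      funext e
      rw [hιW_apply]
      fin_cases e <;>
        simp only [F, f, eqR, eqk, LinearMap.pi_apply, Fin.isValue, Fin.zero_eta, Fin.mk_one,
          Fin.reduceFinMk, Matrix.cons_val, LinearMap.comp_apply, LinearMap.sub_apply,
          LinearMap.mulRight_apply, LinearMap.mulLeft_apply, LinearMap.fst_apply, LinearMap.snd_apply] <;>
        (ext i j; simp [adMat, Matrix.mul_apply, map_sum, map_sub, map_mul])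
    -- uniqueness
    have hinj : ∀ z, F z = 0 → z = 0 := by
      rintro ⟨Y, Y'⟩ hz
      have hcomp : ∀ e : Fin 8, eqR e (Y, Y') = 0 := fun e => congrFun hz e
      have e0 := hcomp 0
      have e1 := hcomp 1
      have e2 := hcomp 2
      have e3 := hcomp 3
      have e4 := hcomp 4
      have e5 := hcomp 5
      have e6 := hcomp 6
      have e7 := hcomp 7
      simp only [eqR, Fin.isValue, Matrix.cons_val, LinearMap.comp_apply, LinearMap.sub_apply,
        LinearMap.mulRight_apply, LinearMap.mulLeft_apply, LinearMap.fst_apply, LinearMap.snd_apply,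
        sub_eq_zero] at e0 e1 e2 e3 e4 e5 e6 e7
      have hYP : ∀ i, Y * adMat k (W.P i) = adMat k (W.P i) * Y := by
        intro i
        fin_cases i
        · exact e1
        · exact e2
      have hY'Q : ∀ i, Y' * adMat k (W.Q i) = adMat k (W.Q i) * Y' := by
        intro i
        fin_cases i
        · exact e4
        · exact e5
      have hreg' : ∀ Z Z' : M4 k, Z * adMat k W.Ω = adMat k W.Ω * Z →
          (∀ i, Z * adMat k (W.P i) = adMat k (W.P i) * Z) → Z' * adMat k W.Ω = adMat k W.Ω * Z' →
          (∀ i, Z' * adMat k (W.Q i) = adMat k (W.Q i) * Z') → Z * adMat k g₀ = adMat k g₀ * Z' →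
          ∃ x y : Ad k, Z = x • (1 : M4 k) + y • adMat k W.Ω ∧ Z' = x • (1 : M4 k) + y • adMat k W.Ω := by
        intro Z Z' a b c e f
        refine hreg Z Z' a b c e ?_
        rw [hg₀]
        exact f
      obtain ⟨hY0, hY'0⟩ := sys_unique W hΩ hd hv hv₁ hw hw₁ (GA.mat_inv_mul W t) (GA.mat_mul_inv W t)
        (GA.mat_mul_inv W t') hTiΩ hTiP hTi'Ω hTi'Q hΓ hreg' hxy hn e0 hYP e3 hY'Q e6 e7
      rw [hY0, hY'0]
      rfl
    -- `(S T, S T′)` solves the system with right-hand side `(0, …, 0, P₀)`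
    have hD : F (S * GA.mat W t, S * GA.mat W t') =
        ιW ![0, 0, 0, 0, 0, 0, 0, W.P 0] := by
      funext e
      rw [hιW_apply]
      have hTiΩ' : (S * GA.mat W t) * adMat k W.Ω = adMat k W.Ω * (S * GA.mat W t) := by
        rw [Matrix.mul_assoc, hTΩ, ← Matrix.mul_assoc, hSΩ, Matrix.mul_assoc]
      have hT'iΩ' : (S * GA.mat W t') * adMat k W.Ω = adMat k W.Ω * (S * GA.mat W t') := by
        rw [Matrix.mul_assoc, hT'Ω, ← Matrix.mul_assoc, hSΩ, Matrix.mul_assoc]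
      have hSP : ∀ i, S * adMat k (W.P i) = adMat k (W.P i) * S := by
        intro i
        fin_cases i
        · exact hsT.1
        · exact hsT.2
      have hSQ : ∀ i, S * adMat k (W.Q i) = adMat k (W.Q i) * S := by
        intro i
        fin_cases i
        · exact hsT'.1
        · exact hsT'.2
      fin_cases e <;>
        simp only [F, eqR, LinearMap.pi_apply, Fin.isValue, Fin.zero_eta, Fin.mk_one, Fin.reduceFinMk,
          Matrix.cons_val, LinearMap.comp_apply, LinearMap.sub_apply, LinearMap.mulRight_apply,
          LinearMap.mulLeft_apply, LinearMap.fst_apply, LinearMap.snd_apply, hadz, sub_eq_zero]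
      · exact hTiΩ'
      · rw [Matrix.mul_assoc, hTP 0, ← Matrix.mul_assoc, hSP 0, Matrix.mul_assoc]
      · rw [Matrix.mul_assoc, hTP 1, ← Matrix.mul_assoc, hSP 1, Matrix.mul_assoc]
      · exact hT'iΩ'
      · rw [Matrix.mul_assoc, hT'Q 0, ← Matrix.mul_assoc, hSQ 0, Matrix.mul_assoc]
      · rw [Matrix.mul_assoc, hT'Q 1, ← Matrix.mul_assoc, hSQ 1, Matrix.mul_assoc]
      · rw [Matrix.mul_assoc, ← hΓ, ← Matrix.mul_assoc, hSΓ, Matrix.mul_assoc]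
      · exact adMat_P0_mul_scalar_mul W hΩ hd hv hv₁ hw hw₁ hTΩ hxy hn
    obtain ⟨⟨A, A'⟩, hAA⟩ := exists_rational_of_unique
      ((Matrix.stdBasis k (Fin 4) (Fin 4)).prod (Matrix.stdBasis k (Fin 4) (Fin 4)))
      (Pi.basis (fun _ : Fin 8 => Matrix.stdBasis k (Fin 4) (Fin 4)))
      ((Matrix.stdBasis (Ad k) (Fin 4) (Fin 4)).prod (Matrix.stdBasis (Ad k) (Fin 4) (Fin 4)))
      (Pi.basis (fun _ : Fin 8 => Matrix.stdBasis (Ad k) (Fin 4) (Fin 4)))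
      ιV ιW hιV hιW hιVinj f F hcompat hinj hD
    rw [hιV_apply, Prod.mk.injEq] at hAA
    exact ⟨A, A', hAA.1, hAA.2⟩
  obtain ⟨A, A', hA, hA'⟩ := hrat
  -- the candidates
  refine ⟨s * t, (torusT W).mul_mem hsT ht, s * t', (torusT' W).mul_mem hsT' ht',
    mem_rationalPoints_of_mat W (s * t) (A := A) hA, mem_rationalPoints_of_mat W (s * t') (A := A') hA', ?_⟩
  -- the conjugation identity
  have hsγ : s⁻¹ * (γ : GA W) * s = γ := by
    rw [mul_assoc, hs_central, ← mul_assoc, inv_mul_cancel, one_mul]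
  calc (s * t)⁻¹ * (γ : GA W) * (s * t') = t⁻¹ * (s⁻¹ * (γ : GA W) * s) * t' := by group
    _ = t⁻¹ * (γ : GA W) * t' := by rw [hsγ]
    _ = γ₀ := hγ

end Main

end Summit.Ventures.HodgeRepro.Tier4.Line1

end
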